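import Literature.AnabelianGeometry.EtaleTheta.Discharge.Sec5Prop52iiiRootKummerOfConnectedTemperoid
import Literature.AnabelianGeometry.EtaleTheta.Discharge.Sec5OfThetaSettingConstantsDictionary

/-!
# [EtTh] Prop. 5.2 (iii) AT THE §5 DATA OF THE SETTING as a clause on the root function, and the [IUTchII] Prop. 1.2 (ii) binder `hM`
# from that clause (Prop. 5.2 (iii) p. 324, Lemma 5.9 (iv) p. 332 / PDF pp. 98, 106) — FILE 3 of the R-C3 group

Mochizuki, *The étale theta function and its Frobenioid-theoretic manifestations*, Publ. RIMS **45** (2009) [MochizukiEtTh2009], Prop. 5.2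
(i)/(iii) p.324 (PDF p.98); Lemma 5.9 (iv) p.332 (PDF p.106) («In particular, omitting the homomorphism `s^⊓-Π_N` yields a mod `N` mono-theta
environment»).  [cite: MochizukiEtTh2009, Prop 5.2 (iii) p.324 (PDF p.98); Lem 5.9 (iv) p.332 (PDF p.106)]

abc-iut cell, layer L2, seat abc-iut-L2-t4 (gen 5; §5 owner lineage, W3-L2-01), abc-iut-L2-lead (gen 4) row R353/R395 R-C3; PROOF-ONLY (0 `def`s),
sequel of `Discharge/Sec5Prop52iiiRootKummerOfConnectedTemperoid.lean` (p448930) read at the §5 data OF THE SETTING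
`ThetaFrobenioid.ofThetaSettingData μ hC hS …` (my gen-4 junction `Discharge/Sec5OfThetaSetting.lean`, p433549: `X := Π^tp_X̲̲ = C.Huu`,
`T := C.thetaEnvData μ hC hS`, `ιX := id` — an `ofConnectedTemperoidData` by `rfl`), where the §5 ↔ §2 dictionary is read with `ι := id`:
* `thetaSectionCompat_iff_rootKummer_ofThetaSettingData` — F-0521 at the Setting (the binder `hcompat` of my p440765
  `frdIsMonoThetaEnv_ofThetaSettingData_of_constantsDictionary` and of abc-iut-L2-t11's p441744) ⟺ «for every `k ∈ Π^tp_Ÿ̲̲`,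
  `s^⊓-gp_N(ρ k) · f_N|_{B_N} = u_{(m⁻¹(η k))⁻¹} · f_N|_{B_N}`» — Prop. 5.2 (iii) at the Setting as a clause on the ROOT FUNCTION alone;
* `frdIsMonoThetaEnv_ofThetaSettingData_of_rootKummer` — the [IUTchII] Prop. 1.2 (ii) binder `hM` («`𝕄(𝔉)` is a mod `N` mono-theta
  environment» for the Setting's `Π^tp_X̲̲[μ_N]`, Lemma 5.9 (iv) "In particular") at the honest `DK`, from the ONE dictionary binder `hD`,
  `hconst`, the §5 named inputs, a theta cocycle `η` of the §2 model AND THE ROOT-FUNCTION CLAUSE in place of `hcompat` — so the residual of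
  the capstone reads: {`hD`, `hconst`, `Facts` (⟸ {hconst, hD}), `η ∈ C.thetaCocycles hC μ`, «the Kummer cocycle of `f_N|_{B_N}` under
  `s^⊓-gp_N`, read through `m`, is `η⁻¹`»} — the last two together = the junction «`θ := Θ̈`» (GAP-LEDGER G-L2t4-2; D-row 13:4xZ).
HONEST FRAMING: kernel-checked compositions over the typed junction; `tf`, `θ`, the roots, the constants are abstract parameters (not inhabited for
the curve); nothing of [EtTh] is asserted unconditionally; typed ≠ proved; no side is taken on anything downstream ([IUTchIII] Cor. 3.12).
-/

noncomputable section

namespace Literature.AnabelianGeometry.EtaleTheta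

open CategoryTheory Opposite Literature.AlgebraicGeometry.Frobenioids Literature.AnabelianGeometry.SemiGraphs
  Literature.AnabelianGeometry.SemiGraphs.GaloisObjects Literature.AlgebraicGeometry.Frobenioids.QuasiTemperoid.BTempConnected

universe v₀

namespace ThetaFrobenioid

variable {p : ℕ} [Fact p.Prime] {D : ThetaSetting p} {E : D.EtaleThetaData} {l : ℕ} {C : E.DoubleUnderline l}
  {e : D.toTemperedCurve.GroupLevelData} {N : ℕ+} (μ : D.CyclotomeMod l N) (hC : D.Compat) (hS : D.Sec2Hyps)
  {D₀ : Type} [Category.{v₀} D₀] {V : FrdIMonoidStub.{0}} {T₀ : RealifiedDivisorMonoids (D₀ := D₀) V}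
  {VD : FrdICatStub.{1, 0, 0} (ConnectedPart (BTemp (C.temperedArithmeticGroup e).Pi))}
  {tf : TemperedFrobenioid T₀ (ConnectedPart (BTemp (C.temperedArithmeticGroup e).Pi)) VD} {hZ : tf.monoidType = MonoidType.Z}
  {hP : ∀ A : (ConnectedPart (BTemp (C.temperedArithmeticGroup e).Pi))ᵒᵖ, IsPerfect (tf.Φ.carrier A)}
  {NH : Subgroup (Field.absoluteGaloisGroup D.K) → tf.category → ℕ+ → Prop} {A₀ : tf.category}
  {hA₀ : PreFrobenioid.IsFrobeniusTrivial tf.toElem A₀} {hA₀' : SemiGraphs.IsGaloisObj A₀.base.obj}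
  {pullFrac : ∀ {A A' : (BiKummerSetting.mkOfConnectedTemperoid (C.temperedArithmeticGroup e) tf hZ hP NH A₀ hA₀ hA₀').C} (_ : A' ⟶ A),
    (BiKummerSetting.mkOfConnectedTemperoid (C.temperedArithmeticGroup e) tf hZ hP NH A₀ hA₀ hA₀').biratUnits A →
      (BiKummerSetting.mkOfConnectedTemperoid (C.temperedArithmeticGroup e) tf hZ hP NH A₀ hA₀ hA₀').biratUnits A'}
  {θ : (BiKummerSetting.mkOfConnectedTemperoid (C.temperedArithmeticGroup e) tf hZ hP NH A₀ hA₀ hA₀').biratUnits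
    (BiKummerSetting.mkOfConnectedTemperoid (C.temperedArithmeticGroup e) tf hZ hP NH A₀ hA₀ hA₀').Aodot}
  {Bl : (BiKummerSetting.mkOfConnectedTemperoid (C.temperedArithmeticGroup e) tf hZ hP NH A₀ hA₀ hA₀').C}
  {Pl : (BiKummerSetting.mkOfConnectedTemperoid (C.temperedArithmeticGroup e) tf hZ hP NH A₀ hA₀ hA₀').FractionPair θ Bl}
  {Rl : (BiKummerSetting.mkOfConnectedTemperoid (C.temperedArithmeticGroup e) tf hZ hP NH A₀ hA₀ hA₀').NthRoot θ Pl C.lPNat pullFrac}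
  (h : ModelFrobenioid.Hypotheses tf.divisorMonoid tf.ratFnFunctor)
  (Q : FrobenioidTheta.ThetaSubquotientStub.{0} (ConnectedPart (BTemp (C.temperedArithmeticGroup e).Pi)))
  (R : (BiKummerSetting.mkOfConnectedTemperoid (C.temperedArithmeticGroup e) tf hZ hP NH A₀ hA₀ hA₀').NthRoot Rl.root Rl.pair N pullFrac)
  (K' : Type) [Field K'] (constEmb : K'ˣ →* tf.biratUnitsModel R.BN) (constEmb_injective : Function.Injective constEmb)
  (hinvc : ∀ g : Aut R.AN.base,
    pull tf.divisorMonoid g.hom (ModelFrobenioid.div R.pair.num) = ModelFrobenioid.div R.pair.num)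
  (hinvp : ∀ y : (C.thetaEnvData μ hC hS).PiX, y ∈ (C.thetaEnvData μ hC hS).PiYdd →
    pull tf.divisorMonoid ((BiKummerSetting.mkOfConnectedTemperoid (C.temperedArithmeticGroup e) tf hZ hP NH A₀ hA₀ hA₀').galoisSurj
      R.AN.base R.αData.isGalois ((ContinuousMulEquiv.refl _) y)).hom (ModelFrobenioid.div R.pair.den) = ModelFrobenioid.div R.pair.den)

/-- **[EtTh] Prop. 5.2 (iii) AT THE §5 DATA OF THE SETTING ⟺ a clause on the root function `f_N|_{B_N}` alone**: the dictionary binder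
`hcompat` (F-0521 `ThetaSectionCompat` with `ι := id`, as consumed by p440765 / p441744) holds iff for every `k ∈ Π^tp_Ÿ̲̲`,
`s^⊓-gp_N(ρ k) · f_N|_{B_N} = u_{(m⁻¹(η k))⁻¹} · f_N|_{B_N}` in `B(B_N^bs)` — p448930's iff with `(T := C.thetaEnvData μ hC hS)`, `(ιX := refl)`.
[cite: MochizukiEtTh2009, Prop 5.2 (iii) p.324 (PDF p.98)] -/
theorem thetaSectionCompat_iff_rootKummer_ofThetaSettingData
    (H : (ofThetaSettingData μ hC hS h Q R K' constEmb constEmb_injective hinvc hinvp).Facts)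
    (m : (ofThetaSettingData μ hC hS h Q R K' constEmb constEmb_injective hinvc hinvp).muTorsion
      (ofThetaSettingData μ hC hS h Q R K' constEmb constEmb_injective hinvc hinvp).BN N ≃* (C.thetaEnvData μ hC hS).mu)
    (η : (C.thetaEnvData μ hC hS).PiYdd → (C.thetaEnvData μ hC hS).mu) :
    (ofThetaSettingData μ hC hS h Q R K' constEmb constEmb_injective hinvc hinvp).ThetaSectionCompat H (C.thetaEnvData μ hC hS)
        (ContinuousMulEquiv.refl _).toMulEquiv m (identifiesPiYdd_ofThetaSettingData' μ hC hS h Q R K' constEmb constEmb_injective hinvc hinvp) η ↔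
      ∀ k : (C.thetaEnvData μ hC hS).PiYdd,
        ((tf.biratAutModel R.BN
            ((ofThetaSettingData μ hC hS h Q R K' constEmb constEmb_injective hinvc hinvp).sgpCap
              ((ofThetaSettingData μ hC hS h Q R K' constEmb constEmb_injective hinvc hinvp).ρ k.1))
            (tf.restrictAlongModel R.pair.num R.pair.isPreStep_num R.root) : tf.biratUnitsModel R.BN) :
            tf.ratFnFunctor.obj (op R.BN.base)) =
          (ModelFrobenioid.unit
              (((m.symm (η k))⁻¹ : (ofThetaSettingData μ hC hS h Q R K' constEmb constEmb_injective hinvc hinvp).muTorsion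
                (ofThetaSettingData μ hC hS h Q R K' constEmb constEmb_injective hinvc hinvp).BN N).1.hom) : tf.ratFnFunctor.obj (op R.BN.base)) *
            ((tf.restrictAlongModel R.pair.num R.pair.isPreStep_num R.root : tf.biratUnitsModel R.BN) : tf.ratFnFunctor.obj (op R.BN.base)) :=
  thetaSectionCompat_iff_rootKummer_ofConnectedTemperoidData (T := C.thetaEnvData μ hC hS) (ιX := ContinuousMulEquiv.refl _) h Q
    C.odd_lPNat R K' constEmb constEmb_injective hinvc hinvp H (C.thetaEnvData μ hC hS) (ContinuousMulEquiv.refl _).toMulEquiv m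
    (identifiesPiYdd_ofThetaSettingData' μ hC hS h Q R K' constEmb constEmb_injective hinvc hinvp) η

variable (hconst : ∀ (ε : Aut R.BN) (k : K'ˣ), tf.biratAutModel R.BN ε (constEmb k) = constEmb k)
  (m : (ofThetaSettingData μ hC hS h Q R K' constEmb constEmb_injective hinvc hinvp).muTorsion
      (ofThetaSettingData μ hC hS h Q R K' constEmb constEmb_injective hinvc hinvp).BN N ≃* (C.thetaEnvData μ hC hS).mu)
  {Cst : Subgroup ((ofThetaSettingData μ hC hS h Q R K' constEmb constEmb_injective hinvc hinvp).biratUnits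
      (ofThetaSettingData μ hC hS h Q R K' constEmb constEmb_injective hinvc hinvp).BN)}
  {ν' : Cst →* (PadicAlgCl p)ˣ}
  (hD : BiratAutAction.ConstantsDictionary
    (biratAutAction_ofConnectedTemperoidData (T := C.thetaEnvData μ hC hS) h Q C.odd_lPNat R (ContinuousMulEquiv.refl _) K' constEmb
      constEmb_injective hinvc hinvp hconst) C μ hC hS (ContinuousMulEquiv.refl _) m Cst ν')

include hD in
/-- **The [IUTchII] Prop. 1.2 (ii) binder `hM` for the §5 data OF THE SETTING from the root-function clause** (Lemma 5.9 (iv) "In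
particular" at the honest `DK`): my p440765 `frdIsMonoThetaEnv_ofThetaSettingData_of_constantsDictionary` with its dictionary binder `hcompat`
REPLACED by «for every `k ∈ Π^tp_Ÿ̲̲`, `s^⊓-gp_N(ρ k) · f_N|_{B_N} = u_{(m⁻¹(η k))⁻¹} · f_N|_{B_N}`» (Prop. 5.2 (iii) in function currency).  RESIDUAL
EXACTLY: the data, `hconst`, the ONE dictionary binder `hD`, the §5 named inputs / `H : Facts`, `η ∈ thetaCocycles` + that clause (= the junction
«`θ := Θ̈`», GAP G-L2t4-2).  [cite: MochizukiEtTh2009, Lem 5.9 (iv) p.332 (PDF p.106); Prop 5.2 (iii) p.324 (PDF p.98)] -/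
theorem frdIsMonoThetaEnv_ofThetaSettingData_of_rootKummer
    (h1 : (ofThetaSettingData μ hC hS h Q R K' constEmb constEmb_injective hinvc hinvp).SectionsFactor)
    (h3 : (ofThetaSettingData μ hC hS h Q R K' constEmb constEmb_injective hinvc hinvp).OuterActionLZ)
    (hsec : (ofThetaSettingData μ hC hS h Q R K' constEmb constEmb_injective hinvc hinvp).SgpCapSection)
    (hcs : (ofThetaSettingData μ hC hS h Q R K' constEmb constEmb_injective hinvc hinvp).SgpCupSection)
    (h8 : (ofThetaSettingData μ hC hS h Q R K' constEmb constEmb_injective hinvc hinvp).ConstantsEqNormalizer)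
    (H : (ofThetaSettingData μ hC hS h Q R K' constEmb constEmb_injective hinvc hinvp).Facts)
    {η : (C.thetaEnvData μ hC hS).PiYdd → (C.thetaEnvData μ hC hS).mu} (hη : η ∈ (C.thetaEnvData μ hC hS).thetaCocycles)
    (hroot : ∀ k : (C.thetaEnvData μ hC hS).PiYdd,
        ((tf.biratAutModel R.BN
            ((ofThetaSettingData μ hC hS h Q R K' constEmb constEmb_injective hinvc hinvp).sgpCap
              ((ofThetaSettingData μ hC hS h Q R K' constEmb constEmb_injective hinvc hinvp).ρ k.1))
            (tf.restrictAlongModel R.pair.num R.pair.isPreStep_num R.root) : tf.biratUnitsModel R.BN) :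
            tf.ratFnFunctor.obj (op R.BN.base)) =
          (ModelFrobenioid.unit
              (((m.symm (η k))⁻¹ : (ofThetaSettingData μ hC hS h Q R K' constEmb constEmb_injective hinvc hinvp).muTorsion
                (ofThetaSettingData μ hC hS h Q R K' constEmb constEmb_injective hinvc hinvp).BN N).1.hom) : tf.ratFnFunctor.obj (op R.BN.base)) *
            ((tf.restrictAlongModel R.pair.num R.pair.isPreStep_num R.root : tf.biratUnitsModel R.BN) : tf.ratFnFunctor.obj (op R.BN.base))) :
    (ofThetaSettingData μ hC hS h Q R K' constEmb constEmb_injective hinvc hinvp).FrdIsMonoThetaEnv h1 h3 hsec hcs h8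
      (dkOfConnectedTemperoidData (T := C.thetaEnvData μ hC hS) h Q C.odd_lPNat R (ContinuousMulEquiv.refl _) K' constEmb
        constEmb_injective hinvc hinvp hconst
        (kxRootNModCyclotome_ofThetaSettingData_of_constantsDictionary μ hC hS h Q R K' constEmb constEmb_injective hinvc hinvp hconst m hD))
      (C.thetaEnvData μ hC hS) :=
  frdIsMonoThetaEnv_ofThetaSettingData_of_constantsDictionary μ hC hS h Q R K' constEmb constEmb_injective hinvc hinvp hconst m hD h1 h3 hsec
    hcs h8 H hη
    ((thetaSectionCompat_iff_rootKummer_ofThetaSettingData μ hC hS h Q R K' constEmb constEmb_injective hinvc hinvp H m η).mpr hroot)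

end ThetaFrobenioid

end Literature.AnabelianGeometry.EtaleTheta

end
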